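import Mathlib
import HarnessLib
import Summits.ResolutionOfSingularities.ResolutionOfSingularities.Theorems.WildQuotientsWildQuotientResolutionPrimeOrbitSeparationUnreachable
import Summits.ResolutionOfSingularities.ResolutionOfSingularities.Theorems.WildQuotientsWildQuotientResolutionKSGoingDownHolds

/-!
# The orbit-separation reshape target of `stub_phaseZeroHighDim` is unreachable — UNCONDITIONALLY
# (crux `WildQuotients.WildQuotientResolution`, stub `stub_phaseZeroHighDim`)

Crux stmt-ResolutionOfSingularities-15640 (`WildQuotientResolution`), registered stub `stub_phaseZeroHighDim`. Hand 6-g4's negative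
side-lemma ✓`StandardForm.not_primeOrbitSeparation_of_commuting_conjugates` (p824255) was conditional on the named fact
`KollarSzaboGoingDown`; with ✓`KSGoingDown.kollarSzaboGoingDown_holds` it now holds unconditionally:

* `not_primeOrbitSeparation_of_commuting_conjugates'` — over an algebraically closed `k`, for crux data with `X′` regular, integral and
  proper over `k`: if `a` and `x a x⁻¹` commute, generate distinct subgroups, and both lie in the inertia group of a closed point of
  `X′`, then on EVERY equivariant proper birational integral model `X″ → X′` their inert loci meet — so the hypothesis `hsep` of
  ✓`phaseZero_of_primeOrbitSeparation` fails on every model (instances: `C_ℓ ≀ C_2` on `ℙ³` in characteristic `2`, `S₄` in characteristic `3`).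

[OURS · crux stmt-ResolutionOfSingularities-15640 · NEGATIVE side-lemma on the reshape target of `stub_phaseZeroHighDim`, now unconditional
(not a refutation of the stub or the crux); counted 0; AI-level work, weaker than expert review.]
[cite: ReichsteinYoussin2000, Appendix (J. Kollár–E. Szabó), Prop. A.2]
-/

-- single-problem summit: the doubled namespace component `ResolutionOfSingularities` is forced
set_option linter.dupNamespace false

noncomputable section

open CategoryTheory AlgebraicGeometry TopologicalSpace IsLocalRing
open Literature.AlgebraicGeometry.Resolution Literature.AlgebraicGeometry.Ramification

namespace Summit.ResolutionOfSingularities.ResolutionOfSingularities.Theorems.WildQuotientResolution.StandardForm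

/-- **The orbit-separation target is unreachable for commuting conjugates — unconditionally** (✓p824255 with the named fact
`KollarSzaboGoingDown` discharged by ✓`KSGoingDown.kollarSzaboGoingDown_holds`). [cite: ReichsteinYoussin2000, Appendix, Prop. A.2] -/
theorem not_primeOrbitSeparation_of_commuting_conjugates'
    (k : Type) [Field k] [IsAlgClosed k] (X' X₁ : Scheme.{0}) (f : X₁ ⟶ Spec (.of k)) (q : X' ⟶ X₁)
    (G : Type) [Group G] [Finite G] (ρ : G →* Aut X')
    [IsSeparated f] [LocallyOfFiniteType f] [QuasiCompact f] [IsIntegral X'] [IsFinite q] [IsProper (q ≫ f)]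
    (hreg : Scheme.IsRegular X') (hρ : ∀ g : G, (ρ g).hom ≫ q = q)
    (a x : G) (hcomm : a * (x * a * x⁻¹) = (x * a * x⁻¹) * a)
    (y₀ : X') (hy₀ : IsClosed ({y₀} : Set X')) (ha : a ∈ inertiaSubgroup ρ y₀) (hxa : x * a * x⁻¹ ∈ inertiaSubgroup ρ y₀)
    (X'' : Scheme.{0}) (π₀ : X'' ⟶ X') (ρ'' : G →* Aut X'') [IsProper π₀] (hbir₀ : IsBirational π₀) [IsIntegral X'']
    (hequiv₀ : ∀ g : G, (ρ'' g).hom ≫ π₀ = π₀ ≫ (ρ g).hom) :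
    ¬ Disjoint {y : X'' | Subgroup.zpowers a ≤ inertiaSubgroup ρ'' y}
        {y : X'' | Subgroup.zpowers (x * a * x⁻¹) ≤ inertiaSubgroup ρ'' y} :=
  not_primeOrbitSeparation_of_commuting_conjugates KSGoingDown.kollarSzaboGoingDown_holds k X' X₁ f q G ρ hreg hρ a x hcomm y₀
    hy₀ ha hxa X'' π₀ ρ'' hbir₀ hequiv₀

end Summit.ResolutionOfSingularities.ResolutionOfSingularities.Theorems.WildQuotientResolution.StandardForm

end
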